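import Summits.BirchSwinnertonDyer.BirchSwinnertonDyer.Theorems.GoldfeldAllTwistsTwoConverseTwinAdditiveSplitPrimeTwistSelmer
import Summits.BirchSwinnertonDyer.BirchSwinnertonDyer.Theorems.GoldfeldAllTwistsTwoConverseTwinAdditiveInertTwistDescent
import HarnessLib

set_option linter.dupNamespace false -- namespace `…BirchSwinnertonDyer.BirchSwinnertonDyer…` is the cell's (D-0017 nested layout)
set_option autoImplicit false

/-!
# Twin″ (item 19140), XII: the twists `49a1^{(−2ℓ)}`, `ℓ ≡ 5 (mod 8)` prime SPLIT in `ℚ(√−7)` —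
# Selmer orders `#S ≤ 4`, `#S' ≤ 2`

Cell `bsd-goldfeld`, seat `bsd-goldfeld-s1p-c301` (gen 2); `--supports stmt-BirchSwinnertonDyer-19140`. The
`−2ℓ`-companion of part VIII (split `ℓ ≡ 5 (mod 8)`, `(−7/ℓ) = +1`: `ℓ = 37, 53, 109, 149, …`), for
`E_{−2ℓ} : y² = x³ − 42ℓ x² + 448ℓ² x`, `S = S(−42ℓ, 448ℓ²)`, `S' = S(84ℓ, −28ℓ²)` (numerically
`S = {1,7,ℓ,7ℓ}`, `S' = {1,−7}` for `ℓ = 37`):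

* `card_twoIsogenySelmerGroup_twoSplitFiveTwist_le`: **`#S ≤ 4`** — `S` lies in the positive divisors of
  `14ℓ` minus `{2, 14}` (both die at `ℓ`: `2, 14, 32, 224` are non-residues as `(2/ℓ) = −1`, `(7/ℓ) = +1`;
  part VIII's `not_isSoluble_padic_of_nonresidue_of_sq_dvd`), and `#S` is a power of `2`.
* `card_twoIsogenySelmerGroup'_twoSplitFiveTwist_le`: **`#S' ≤ 2`** — of the `16` squarefree divisors of
  `−28ℓ²`: `−1, −2, 7, 14, −ℓ, −2ℓ, 7ℓ, 14ℓ` die at `7` (`ℓ` is a nonzero SQUARE mod `7` by reciprocity;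
  `7 ∥ 7168ℓ²`; Zywina's `isSquare_zmod_of_isSoluble_padic`), `2, −14` die at `ℓ` (same lemma of part VIII,
  `2`, `−14` non-residues), and `ℓ, −7ℓ, 2ℓ` die at `2` (`not_isSoluble_two_twoSplitFive`: residues mod `32`,
  `decide`); three classes `{1, −7, −14ℓ}` survive, and `#S'` is a power of `2`.

Consequences (rank `≤ 1`; `Ш[2] = 0` in rank one; twin″ ⟺ a `2`-adic unit statement) in part XIII.
Numerically (gen-0 kit tables) all such twists with `|d| ≤ 3000` have analytic rank `1`, `Ш[2] = 0`,
`#Ш_an = 1`. HONEST FRAMING: no `BSD(W,2)` is proved; BSD is not proved by any of this.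

References: Silverman, *AEC* (2009), X.4.9–X.4.10 [SilvermanAEC2009]; Zywina, arXiv:2502.01957, Lemma 3.1 [Zywina2025].
-/

noncomputable section

open scoped Classical

open WeierstrassCurve Literature.NumberTheory.EllipticCurves
open Literature.NumberTheory.EllipticCurves.Zywina2025 (exists_padicInt_of_isSoluble
  isSquare_zmod_of_isSoluble_padic)

namespace Summit.BirchSwinnertonDyer.BirchSwinnertonDyer.Theorems.GoldfeldGoodTwists

/-! ## §1. Inputs -/

/-- Residues mod `ℓ` for `ℓ ≡ 5 (mod 8)` split: `2, 14, 32, 224, −14` are non-residues. [folklore] -/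
private theorem residues_mod_l_splitFive {l : ℕ} [Fact l.Prime] (hl8 : l % 8 = 5)
    (hl7 : legendreSym l (-7) = 1) :
    ¬ IsSquare ((2 : ℤ) : ZMod l) ∧ ¬ IsSquare ((14 : ℤ) : ZMod l) ∧ ¬ IsSquare ((32 : ℤ) : ZMod l) ∧
      ¬ IsSquare ((224 : ℤ) : ZMod l) ∧ ¬ IsSquare ((-14 : ℤ) : ZMod l) := by
  have hl2 : l ≠ 2 := by rintro rfl; norm_num at hl8
  have h2 : legendreSym l 2 = -1 := by
    rw [legendreSym.at_two hl2, ZMod.χ₈_nat_eq_if_mod_eight]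
    simp [hl8, show l % 2 = 1 by omega]
  have hm1 : legendreSym l (-1) = 1 := by
    rw [legendreSym.at_neg_one hl2, ZMod.χ₄_nat_one_mod_four (by omega)]
  have h7 : legendreSym l 7 = 1 := by
    have hmul : legendreSym l (-7) = legendreSym l (-1) * legendreSym l 7 := by
      rw [← legendreSym.mul]; norm_num
    rw [hmul, hm1, one_mul] at hl7
    exact hl7
  have h20 : ((2 : ℤ) : ZMod l) ≠ 0 := by
    intro h
    have : ((2 : ℕ) : ZMod l) = 0 := by exact_mod_cast h
    rw [ZMod.natCast_eq_zero_iff] at this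
    exact hl2 ((Nat.prime_dvd_prime_iff_eq Fact.out Nat.prime_two).mp this)
  have h40 : ((4 : ℤ) : ZMod l) ≠ 0 := by
    have : ((4 : ℤ) : ZMod l) = ((2 : ℤ) : ZMod l) * ((2 : ℤ) : ZMod l) := by push_cast; norm_num
    rw [this]; exact mul_ne_zero h20 h20
  have h16 : legendreSym l 16 = 1 := by
    rw [show (16 : ℤ) = 4 ^ 2 by norm_num]; exact legendreSym.sq_one' l h40
  have h14 : legendreSym l 14 = -1 := by
    rw [show (14 : ℤ) = 2 * 7 by norm_num, legendreSym.mul, h2, h7]; norm_num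
  refine ⟨(legendreSym.eq_neg_one_iff l).mp h2, (legendreSym.eq_neg_one_iff l).mp h14,
    (legendreSym.eq_neg_one_iff l).mp ?_, (legendreSym.eq_neg_one_iff l).mp ?_,
    (legendreSym.eq_neg_one_iff l).mp ?_⟩
  · rw [show (32 : ℤ) = 16 * 2 by norm_num, legendreSym.mul, h16, h2]; norm_num
  · rw [show (224 : ℤ) = 16 * 14 by norm_num, legendreSym.mul, h16, h14]; norm_num
  · rw [show (-14 : ℤ) = -1 * 14 by norm_num, legendreSym.mul, hm1, h14]; norm_num

/-- The nonzero squares mod `7` are `1, 2, 4`. [folklore] -/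
private theorem zmod_seven_square_cases : ∀ q : ZMod 7, q ≠ 0 → (q * q = 1 ∨ q * q = 2 ∨ q * q = 4) := by
  decide

/-- Non-residue table mod `7` for a nonzero square `x`. [folklore] -/
private theorem zmod_seven_table_split : ∀ x : ZMod 7, (x = 1 ∨ x = 2 ∨ x = 4) →
    ∀ r : ZMod 7, r * r ≠ -1 ∧ r * r ≠ -2 ∧ r * r ≠ -x ∧ r * r ≠ -2 * x ∧ r * r ≠ -4 * x ∧
      r * r ≠ -4 * x ^ 2 ∧ r * r ≠ -2 * x ^ 2 := by
  decide

/-- `ℓ` split with `ℓ ≡ 1 (mod 4)`, `ℓ ≠ 7`: `ℓ` is a nonzero square mod `7` (reciprocity). [folklore] -/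
private theorem l_square_mod_seven {l : ℕ} [Fact l.Prime] (hl4 : l % 4 = 1) (hl7 : legendreSym l (-7) = 1)
    (hl7' : l ≠ 7) : (l : ZMod 7) ≠ 0 ∧ ((l : ZMod 7) = 1 ∨ (l : ZMod 7) = 2 ∨ (l : ZMod 7) = 4) := by
  haveI : Fact (Nat.Prime 7) := ⟨by norm_num⟩
  have hl2 : l ≠ 2 := by rintro rfl; norm_num at hl4
  have hl07 : ((l : ℤ) : ZMod 7) ≠ 0 := by
    rw [Ne, ZMod.intCast_zmod_eq_zero_iff_dvd]
    intro h
    exact hl7' ((Nat.prime_dvd_prime_iff_eq (by norm_num) Fact.out).mp (by exact_mod_cast h)).symm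
  have h7 : legendreSym l 7 = 1 := by
    have hm1 : legendreSym l (-1) = 1 := by
      rw [legendreSym.at_neg_one hl2, ZMod.χ₄_nat_one_mod_four hl4]
    have hmul : legendreSym l (-7) = legendreSym l (-1) * legendreSym l 7 := by
      rw [← legendreSym.mul]; norm_num
    rw [hmul, hm1, one_mul] at hl7
    exact hl7
  have h7l : legendreSym 7 l = 1 := by
    rw [legendreSym.quadratic_reciprocity_one_mod_four hl4 (by norm_num)]; exact_mod_cast h7
  obtain ⟨q, hq⟩ := (legendreSym.eq_one_iff 7 hl07).mp h7l
  push_cast at hq hl07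
  have hq0 : q ≠ 0 := by rintro rfl; apply hl07; rw [hq]; ring
  refine ⟨hl07, ?_⟩
  rw [hq]
  exact zmod_seven_square_cases q hq0

/-- The finite check behind the `2`-adic lemma: for `x ≡ 5 (mod 8)` in `ℤ/32` the six chart equations of
the classes `ℓ, −7ℓ, 2ℓ` of `S(84ℓ, −28ℓ²)` have no solution. [folklore] -/
private theorem zmod_thirtytwo_key_splitFive : ∀ x : ZMod 32, (x = 5 ∨ x = 13 ∨ x = 21 ∨ x = 29) →
    ∀ T S : ZMod 32,
      (S ^ 2 ≠ x * (1 + 84 * T ^ 2 - 28 * T ^ 4) ∧ S ^ 2 ≠ x * (-28 + 84 * T ^ 2 + T ^ 4)) ∧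
      (S ^ 2 ≠ x * (-7 + 84 * T ^ 2 + 4 * T ^ 4) ∧ S ^ 2 ≠ x * (4 + 84 * T ^ 2 - 7 * T ^ 4)) ∧
      (S ^ 2 ≠ x * (2 + 84 * T ^ 2 - 14 * T ^ 4) ∧ S ^ 2 ≠ x * (-14 + 84 * T ^ 2 + 2 * T ^ 4)) := by
  decide

/-- One quartic `(84ℓ, d, d')` over `ℚ₂` read modulo `32`: if both chart equations are excluded in `ℤ/32`,
there is no `ℚ₂`-point. [folklore] -/
private theorem not_isSoluble_two_of_zmod32 {l : ℕ} {d d' : ℤ}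
    (hk : ∀ T S : ZMod 32,
      S ^ 2 ≠ (d : ZMod 32) + (84 * l : ℤ) * T ^ 2 + (d' : ZMod 32) * T ^ 4 ∧
      S ^ 2 ≠ (d' : ZMod 32) + (84 * l : ℤ) * T ^ 2 + (d : ZMod 32) * T ^ 4) :
    ¬ ((twoIsogenyQuartic (84 * l) d d').map (Int.castRingHom ℚ_[2])).IsSoluble := by
  haveI : Fact (Nat.Prime 2) := ⟨Nat.prime_two⟩
  intro h
  obtain ⟨f, f', hff, t, s, hs⟩ := exists_padicInt_of_isSoluble h
  have h2 := congrArg (PadicInt.toZModPow 5 : ℤ_[2] →+* ZMod (2 ^ 5)) hs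
  simp only [map_pow, map_add, map_mul, map_intCast] at h2
  rcases hff with ⟨rfl, rfl⟩ | ⟨rfl, rfl⟩
  · exact (hk (PadicInt.toZModPow 5 t) (PadicInt.toZModPow 5 s)).1 h2
  · exact (hk (PadicInt.toZModPow 5 t) (PadicInt.toZModPow 5 s)).2 h2

/-- **`2`-adic lemma**: for `ℓ ≡ 5 (mod 8)` the classes `ℓ`, `−7ℓ`, `2ℓ` of `S(84ℓ, −28ℓ²)` have no
`ℚ₂`-point. [cite: SilvermanAEC2009, Prop. X.4.9 and Example X.4.10] -/
theorem not_isSoluble_two_twoSplitFive {l : ℕ} (hl8 : l % 8 = 5) :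
    ¬ ((twoIsogenyQuartic (84 * l) l (-28 * l)).map (Int.castRingHom ℚ_[2])).IsSoluble ∧
    ¬ ((twoIsogenyQuartic (84 * l) (-7 * l) (4 * l)).map (Int.castRingHom ℚ_[2])).IsSoluble ∧
    ¬ ((twoIsogenyQuartic (84 * l) (2 * l) (-14 * l)).map (Int.castRingHom ℚ_[2])).IsSoluble := by
  have hx : (l : ZMod 32) = 5 ∨ (l : ZMod 32) = 13 ∨ (l : ZMod 32) = 21 ∨ (l : ZMod 32) = 29 := by
    have h : l % 32 = 5 ∨ l % 32 = 13 ∨ l % 32 = 21 ∨ l % 32 = 29 := by omega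
    rw [← ZMod.natCast_mod l 32]
    rcases h with h | h | h | h <;> rw [h] <;> norm_num
  have key := zmod_thirtytwo_key_splitFive (l : ZMod 32) hx
  refine ⟨not_isSoluble_two_of_zmod32 fun T S => ?_, not_isSoluble_two_of_zmod32 fun T S => ?_,
    not_isSoluble_two_of_zmod32 fun T S => ?_⟩ <;> push_cast
  · exact ⟨fun h => (key T S).1.1 (by rw [h]; ring), fun h => (key T S).1.2 (by rw [h]; ring)⟩
  · exact ⟨fun h => (key T S).2.1.1 (by rw [h]; ring), fun h => (key T S).2.1.2 (by rw [h]; ring)⟩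
  · exact ⟨fun h => (key T S).2.2.1 (by rw [h]; ring), fun h => (key T S).2.2.2 (by rw [h]; ring)⟩

/-! ## §2. The Selmer orders -/

/-- **`#S(−42ℓ, 448ℓ²) ≤ 4`** for a prime `ℓ ≡ 5 (mod 8)` with `(−7/ℓ) = +1` (`S ⊆ {1,7,ℓ,2ℓ,7ℓ,14ℓ}`: the classes
`2`, `14` die at `ℓ`; `#S = 2^k`). [cite: SilvermanAEC2009, Prop. X.4.9 and Example X.4.10] -/
theorem card_twoIsogenySelmerGroup_twoSplitFiveTwist_le {l : ℕ} [Fact l.Prime] (hl8 : l % 8 = 5)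
    (hl7 : legendreSym l (-7) = 1) :
    (twoIsogenySelmerGroup (-42 * l) (448 * l ^ 2)).card ≤ 4 := by
  have hl : l.Prime := Fact.out
  have hlp : Prime (l : ℤ) := Nat.prime_iff_prime_int.mp hl
  have hl0 : (l : ℤ) ≠ 0 := by exact_mod_cast hl.ne_zero
  have hlpos : (0 : ℤ) < l := by exact_mod_cast hl.pos
  have hb : (448 * l ^ 2 : ℤ) ≠ 0 := by positivity
  obtain ⟨h2, h14, h32, h224, -⟩ := residues_mod_l_splitFive hl8 hl7
  have hsub : twoIsogenySelmerGroup (-42 * l) (448 * l ^ 2) ⊆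
      ({1, 7, (l : ℤ) * 1, (l : ℤ) * 2, (l : ℤ) * 7, (l : ℤ) * 14} : Finset ℤ) := by
    intro d hd
    rw [mem_twoIsogenySelmerGroup_iff hb] at hd
    obtain ⟨hsqf, ⟨d', hdd'⟩, hloc⟩ := hd
    have hd'eq : (448 * l ^ 2 : ℤ) / d = d' := by
      rw [hdd', Int.mul_ediv_cancel_left _ hsqf.ne_zero]
    rw [hd'eq] at hloc
    obtain ⟨hreal, hpadic⟩ := hloc
    have hdpos : 0 < d := by
      rcases lt_or_gt_of_ne hsqf.ne_zero with hneg | hpos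
      · exfalso
        have hbpos : (0 : ℤ) < 448 * (l : ℤ) ^ 2 := by positivity
        have hd'neg : d' < 0 := by
          by_contra hcon
          nlinarith [mul_nonpos_iff.mpr (Or.inr ⟨hneg.le, le_of_not_gt hcon⟩)]
        exact not_isSoluble_real_twoIsogenyQuartic_of_neg hneg hd'neg (by linarith) hreal
      · exact hpos
    have hne2 : d ≠ 2 := by
      rintro rfl
      have hd'1 : d' = (l : ℤ) ^ 2 * 224 := by linarith
      exact not_isSoluble_padic_of_nonresidue_of_sq_dvd (p := l) (c := -42) (e' := 224) (by ring)
        hd'1 h2 h224 (hpadic l)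
    have hne14 : d ≠ 14 := by
      rintro rfl
      have hd'1 : d' = (l : ℤ) ^ 2 * 32 := by linarith
      exact not_isSoluble_padic_of_nonresidue_of_sq_dvd (p := l) (c := -42) (e' := 32) (by ring)
        hd'1 h14 h32 (hpadic l)
    have h0 : d ∣ 448 * (l : ℤ) ^ 2 := ⟨d', hdd'⟩
    have h1 : d ∣ (14 * (l : ℤ)) ^ 6 := h0.trans ⟨16807 * (l : ℤ) ^ 4, by ring⟩
    have h14l : d ∣ 14 * (l : ℤ) := (hsqf.dvd_pow_iff_dvd (by norm_num)).mp h1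
    by_cases hld : (l : ℤ) ∣ d
    · obtain ⟨e, rfl⟩ := hld
      have he14 : e ∣ 14 := by
        have : (l : ℤ) * e ∣ (l : ℤ) * 14 := by rw [mul_comm (l : ℤ) 14]; exact h14l
        exact (mul_dvd_mul_iff_left hl0).mp this
      have hepos : 0 < e := pos_of_mul_pos_right hdpos hlpos.le
      have hele : e ≤ 14 := Int.le_of_dvd (by norm_num) he14
      interval_cases e <;> first | (exfalso; omega) | simp
    · have hcop : IsCoprime d (l : ℤ) := ((hlp.irreducible.coprime_iff_not_dvd).mpr hld).symm
      have hd14 : d ∣ 14 := hcop.dvd_of_dvd_mul_right h14l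
      have hle : d ≤ 14 := Int.le_of_dvd (by norm_num) hd14
      interval_cases d <;> first | (exfalso; omega) | simp
  have hab := hab_inertTwoTwist hl.pos
  obtain ⟨k, hk⟩ := exists_card_twoIsogenySelmerGroup_eq_two_pow hab
  have hle6 : (twoIsogenySelmerGroup (-42 * l) (448 * l ^ 2)).card ≤ 6 :=
    (Finset.card_le_card hsub).trans Finset.card_le_six
  rw [hk] at hle6 ⊢
  have hk3 : k < 3 := (Nat.pow_lt_pow_iff_right one_lt_two).mp (lt_of_le_of_lt hle6 (by norm_num))
  calc 2 ^ k ≤ 2 ^ 2 := Nat.pow_le_pow_right two_pos (by omega)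
    _ = 4 := by norm_num

/-- **`#S'(−42ℓ, 448ℓ²) = #S(84ℓ, −28ℓ²) ≤ 2`** for a prime `ℓ ≡ 5 (mod 8)` with `(−7/ℓ) = +1`:
`S' ⊆ {1, −7, −14ℓ}` (eight classes die at `7`, two at `ℓ`, three at `2`) and `#S'` is a power of `2`.
[cite: SilvermanAEC2009, Prop. X.4.9] [cite: Zywina2025, Lemma 3.1 (proof)] -/
theorem card_twoIsogenySelmerGroup'_twoSplitFiveTwist_le {l : ℕ} [Fact l.Prime] (hl8 : l % 8 = 5)
    (hl7 : legendreSym l (-7) = 1) :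
    (twoIsogenySelmerGroup' (-42 * l) (448 * l ^ 2)).card ≤ 2 := by
  have hl : l.Prime := Fact.out
  haveI : Fact (Nat.Prime 7) := ⟨by norm_num⟩
  have hlp : Prime (l : ℤ) := Nat.prime_iff_prime_int.mp hl
  have hl0 : (l : ℤ) ≠ 0 := by exact_mod_cast hl.ne_zero
  have hl7' : l ≠ 7 := by rintro rfl; norm_num at hl8
  obtain ⟨hl07, hlsq⟩ := l_square_mod_seven (by omega) hl7 hl7'
  have htab := zmod_seven_table_split (l : ZMod 7) hlsq
  have hl07Z : ((l : ℤ) : ZMod 7) ≠ 0 := by exact_mod_cast hl07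
  obtain ⟨h2, -, -, -, hm14⟩ := residues_mod_l_splitFive hl8 hl7
  obtain ⟨h2l, h7l, h22l⟩ := not_isSoluble_two_twoSplitFive hl8
  have hA : (-2 * (-42 * l : ℤ)) = 84 * l := by ring
  have hB : ((-42 * l : ℤ) ^ 2 - 4 * (448 * l ^ 2)) = -28 * l ^ 2 := by ring
  have hb : (-28 * l ^ 2 : ℤ) ≠ 0 := mul_ne_zero (by norm_num) (pow_ne_zero 2 hl0)
  have hsub : twoIsogenySelmerGroup' (-42 * l) (448 * l ^ 2) ⊆ ({1, -7, (l : ℤ) * (-14)} : Finset ℤ) := by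
    intro d hd
    rw [twoIsogenySelmerGroup'_eq, hA, hB, mem_twoIsogenySelmerGroup_iff hb] at hd
    obtain ⟨hsqf, ⟨d', hdd'⟩, hloc⟩ := hd
    have hd'eq : (-28 * l ^ 2 : ℤ) / d = d' := by
      rw [hdd', Int.mul_ediv_cancel_left _ hsqf.ne_zero]
    rw [hd'eq] at hloc
    obtain ⟨-, hpadic⟩ := hloc
    have hdisc : ∀ x y : ℤ, x * y = -28 * (l : ℤ) ^ 2 →
        (7 : ℤ) ∣ (84 * (l : ℤ)) ^ 2 - 4 * x * y ∧ ¬ (7 : ℤ) ^ 2 ∣ (84 * (l : ℤ)) ^ 2 - 4 * x * y := by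
      intro x y hxy
      have e1 : (84 * (l : ℤ)) ^ 2 - 4 * x * y = 7168 * (l : ℤ) ^ 2 := by rw [mul_assoc, hxy]; ring
      rw [e1]
      refine ⟨⟨1024 * (l : ℤ) ^ 2, by ring⟩, not_sq_seven_dvd_of_not_dvd' fun h => hl7' ?_⟩
      exact ((Nat.prime_dvd_prime_iff_eq (by norm_num) hl).mp h).symm
    have h7p : Prime (7 : ℤ) := Int.prime_iff_natAbs_prime.mpr (by norm_num)
    have hnd7 : ∀ k : ℤ, ¬ (7 : ℤ) ∣ k → ∀ n : ℕ, ¬ (7 : ℤ) ∣ k * (l : ℤ) ^ n := by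
      intro k hk n h
      rcases h7p.dvd_or_dvd h with h5 | h5
      · exact hk h5
      · exact hl07Z ((ZMod.intCast_zmod_eq_zero_iff_dvd _ 7).mpr (h7p.dvd_of_dvd_pow h5))
    have kill : ∀ x y : ℤ, x * y = -28 * (l : ℤ) ^ 2 → ¬ (7 : ℤ) ∣ x →
        ((twoIsogenyQuartic (84 * l) x y).map (Int.castRingHom ℚ_[7])).IsSoluble →
        ∃ r : ZMod 7, ((x : ℤ) : ZMod 7) = r * r := by
      intro x y hxy hx hsol
      obtain ⟨hB1, hB2⟩ := hdisc x y hxy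
      exact (isSquare_zmod_of_isSoluble_padic (p := 7) (by norm_num) hx hB1 hB2 hsol).2
    have kill' : ∀ x y : ℤ, x * y = -28 * (l : ℤ) ^ 2 → ¬ (7 : ℤ) ∣ y →
        ((twoIsogenyQuartic (84 * l) x y).map (Int.castRingHom ℚ_[7])).IsSoluble →
        ∃ r : ZMod 7, ((y : ℤ) : ZMod 7) = r * r := by
      intro x y hxy hy hsol
      exact kill y x (by rw [mul_comm]; exact hxy) hy
        ((isSoluble_map_twoIsogenyQuartic_comm _ _ _ _).mp hsol)
    have h0 : d ∣ -28 * (l : ℤ) ^ 2 := ⟨d', hdd'⟩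
    have h1 : d ∣ (14 * (l : ℤ)) ^ 2 := h0.trans ⟨-7, by ring⟩
    have h14l : d ∣ 14 * (l : ℤ) := (hsqf.dvd_pow_iff_dvd (by norm_num)).mp h1
    simp only [Finset.mem_insert, Finset.mem_singleton]
    by_cases hld : (l : ℤ) ∣ d
    · obtain ⟨e, rfl⟩ := hld
      have he14 : e ∣ 14 := by
        have : (l : ℤ) * e ∣ (l : ℤ) * 14 := by rw [mul_comm (l : ℤ) 14]; exact h14l
        exact (mul_dvd_mul_iff_left hl0).mp this
      have hd'e : e * d' = -28 * l := mul_left_cancel₀ hl0 (by linear_combination (-1 : ℤ) * hdd')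
      have hele : e ≤ 14 := Int.le_of_dvd (by norm_num) he14
      have hege : -14 ≤ e := by
        have := Int.le_of_dvd (by norm_num) ((Int.neg_dvd).mpr he14); linarith
      -- at `2`: `e = 1, -7, 2`
      have hne1 : e ≠ 1 := by
        rintro rfl
        have hd'1 : d' = -28 * (l : ℤ) := by linarith
        rw [hd'1] at hpadic
        exact h2l (by simpa using hpadic 2)
      have hnem7 : e ≠ -7 := by
        rintro rfl
        have hd'1 : d' = 4 * (l : ℤ) := by linarith
        rw [hd'1] at hpadic
        exact h7l (by have := hpadic 2; rwa [show (l : ℤ) * -7 = -7 * l by ring] at this)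
      have hne2 : e ≠ 2 := by
        rintro rfl
        have hd'1 : d' = -14 * (l : ℤ) := by linarith
        rw [hd'1] at hpadic
        exact h22l (by have := hpadic 2; rwa [show (l : ℤ) * 2 = 2 * l by ring] at this)
      -- at `7`: `e = -1, -2, 7, 14`
      have hnem1 : e ≠ -1 := by
        rintro rfl
        obtain ⟨r, hr⟩ := kill ((l : ℤ) * -1) d' (by linear_combination (l : ℤ) * hd'e)
          (by rw [mul_comm]; exact hnd7 (-1) (by decide) 1 ∘ (by intro h; simpa using h)) (hpadic 7)
        push_cast at hr
        exact (htab r).2.2.1 (by rw [← hr]; ring)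
      have hnem2 : e ≠ -2 := by
        rintro rfl
        obtain ⟨r, hr⟩ := kill ((l : ℤ) * -2) d' (by linear_combination (l : ℤ) * hd'e)
          (by rw [mul_comm]; exact hnd7 (-2) (by decide) 1 ∘ (by intro h; simpa using h)) (hpadic 7)
        push_cast at hr
        exact (htab r).2.2.2.1 (by rw [← hr]; ring)
      have hne7 : e ≠ 7 := by
        rintro rfl
        have hd'1 : d' = -4 * (l : ℤ) := by linarith
        obtain ⟨r, hr⟩ := kill' ((l : ℤ) * 7) d' (by linear_combination (l : ℤ) * hd'e)
          (by rw [hd'1]; exact hnd7 (-4) (by decide) 1 ∘ (by intro h; simpa using h)) (hpadic 7)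
        rw [hd'1] at hr; push_cast at hr
        exact (htab r).2.2.2.2.1 (by rw [← hr])
      have hne14 : e ≠ 14 := by
        rintro rfl
        have hd'1 : d' = -2 * (l : ℤ) := by linarith
        obtain ⟨r, hr⟩ := kill' ((l : ℤ) * 14) d' (by linear_combination (l : ℤ) * hd'e)
          (by rw [hd'1]; exact hnd7 (-2) (by decide) 1 ∘ (by intro h; simpa using h)) (hpadic 7)
        rw [hd'1] at hr; push_cast at hr
        exact (htab r).2.2.2.1 (by rw [← hr])
      obtain ⟨k, hk⟩ := he14
      interval_cases e <;> first | (exfalso; omega) | simp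
    · have hcop : IsCoprime d (l : ℤ) := ((hlp.irreducible.coprime_iff_not_dvd).mpr hld).symm
      have hd14 : d ∣ 14 := hcop.dvd_of_dvd_mul_right h14l
      have hle : d ≤ 14 := Int.le_of_dvd (by norm_num) hd14
      have hge : -14 ≤ d := by
        have := Int.le_of_dvd (by norm_num) ((Int.neg_dvd).mpr hd14); linarith
      have hnm1 : d ≠ -1 := by
        rintro rfl
        obtain ⟨r, hr⟩ := kill (-1) d' hdd'.symm (by decide) (hpadic 7)
        push_cast at hr
        exact (htab r).1 hr.symm
      have hnm2 : d ≠ -2 := by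
        rintro rfl
        obtain ⟨r, hr⟩ := kill (-2) d' hdd'.symm (by decide) (hpadic 7)
        push_cast at hr
        exact (htab r).2.1 hr.symm
      have hn7 : d ≠ 7 := by
        rintro rfl
        have hd'1 : d' = -4 * (l : ℤ) ^ 2 := by linarith
        obtain ⟨r, hr⟩ := kill' 7 d' hdd'.symm (by rw [hd'1]; exact hnd7 (-4) (by decide) 2) (hpadic 7)
        rw [hd'1] at hr; push_cast at hr
        exact (htab r).2.2.2.2.2.1 hr.symm
      have hn14 : d ≠ 14 := by
        rintro rfl
        have hd'1 : d' = -2 * (l : ℤ) ^ 2 := by linarith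
        obtain ⟨r, hr⟩ := kill' 14 d' hdd'.symm (by rw [hd'1]; exact hnd7 (-2) (by decide) 2) (hpadic 7)
        rw [hd'1] at hr; push_cast at hr
        exact (htab r).2.2.2.2.2.2 hr.symm
      -- at `ℓ`: `2` and `-14`
      have hn2 : d ≠ 2 := by
        rintro rfl
        have hd'1 : d' = (l : ℤ) ^ 2 * -14 := by linarith
        exact not_isSoluble_padic_of_nonresidue_of_sq_dvd (p := l) (c := 84) (e' := -14) (by ring)
          hd'1 h2 hm14 (hpadic l)
      have hnm14 : d ≠ -14 := by
        rintro rfl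
        have hd'1 : d' = (l : ℤ) ^ 2 * 2 := by linarith
        exact not_isSoluble_padic_of_nonresidue_of_sq_dvd (p := l) (c := 84) (e' := 2) (by ring)
          hd'1 hm14 h2 (hpadic l)
      obtain ⟨k, hk⟩ := hd14
      interval_cases d <;> first | (exfalso; omega) | simp
  have hab := hab_inertTwoTwist hl.pos
  obtain ⟨k, hk⟩ := exists_card_twoIsogenySelmerGroup'_eq_two_pow hab
  have hle3 : (twoIsogenySelmerGroup' (-42 * l) (448 * l ^ 2)).card ≤ 3 :=
    (Finset.card_le_card hsub).trans Finset.card_le_three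
  rw [hk] at hle3 ⊢
  have hk2 : k < 2 := (Nat.pow_lt_pow_iff_right one_lt_two).mp (lt_of_le_of_lt hle3 (by norm_num))
  calc 2 ^ k ≤ 2 ^ 1 := Nat.pow_le_pow_right two_pos (by omega)
    _ = 2 := by norm_num

end Summit.BirchSwinnertonDyer.BirchSwinnertonDyer.Theorems.GoldfeldGoodTwists

end
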